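import Literature.Geometry.Kaehler.ComplexTorusIntegralLefschetzDecompositionDegreeThree
import HarnessLib

/-!
# The integral Lefschetz decomposition in degree three as a group:
# `H³(X, ℤ)/(P³(X, ℤ) ⊕ θ ∧ H¹(X, ℤ)) ≅ ⊕_x ℤ/((g−1) · d_{t(a(x))})` for a polarised complex torus of type `(d₁, …, d_g)`

Layer `Literature/Geometry/Kaehler`, namespace `Literature.Geometry.Kaehler.ComplexTorus`; lane `lit-hodgefound` (Track 2
foundations library), seat p09, generation 38, row g38-#2. THEOREMS ONLY (0 definitions); no named fact, net debt 0. Sequel of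
g37-#1 `ComplexTorusIntegralLefschetzDecompositionDegreeThree`, which proved that for a Riemann form of type `d₁ ∣ ⋯ ∣ d_g` on a
complex torus `X` of dimension `g = j + 2` the printed Lefschetz decomposition `H³ = P³ ⊕ L H¹` ((5.22); `L = θ ∧ (−)`,
`P³(X, ℤ) = H³(X, ℤ) ∩ ker θ^{∧(g−2)} ∧ (−)` the primitive lattice, Thm. 5.4.2) holds over `ℤ` exactly up to the finite index
`[H³(X, ℤ) : P³(X, ℤ) ⊕ θ ∧ H¹(X, ℤ)] = ∏_x (g−1) · d_{t(a(x))}` (`x` over the `2g` letters `λ₁, …, μ_g`, `a(x)` the index of `x`,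
`t(a)` the largest index `≠ a`). This file determines the GROUP:

  **`H³(X, ℤ)/(P³(X, ℤ) ⊕ θ ∧ H¹(X, ℤ)) ≃+ ⊕_x ℤ/((g−1) · d_{t(a(x))}) = (ℤ/((g−1) d_g))^{2g−2} ⊕ (ℤ/((g−1) d_{g−1}))²`**,

for every type; **`(ℤ/(g−1))^{2g}` on a principally polarised torus** (p.p. threefold: `H³(X, ℤ)/(P³(X, ℤ) ⊕ θ ∧ H¹(X, ℤ)) ≅ (ℤ/2)^6`,
p.p. fourfold `(ℤ/3)^8`; in degree two the analogous quotient `H²(X, ℤ)/(ℤ θ ⊕ P²(X, ℤ))` is cyclic of order `g · d_g`, g35-#2).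

Proof (§0 two lattice lemmas, §1 the theorem): with `Ψ = θ^{∧(g−2)} ∧ (−) : H³ → H^{2g−1}` and `K = θ ∧ H¹(X, ℤ) ≤ H = H³(X, ℤ)`,
the first isomorphism theorem gives `H/(K ⊕ (H ∩ ker Ψ)) ≃+ Ψ(H)/Ψ(K)` (§0, the group form of g37-#1's index identity
`[H : K ⊕ (H ∩ ker Ψ)] = [Ψ H : Ψ K]`); and by g37-#1 §3–§4 both `Ψ(H³(X, ℤ)) = ⊕_x ℤ · c_x · dx_{(x̄)°}`
(`c_x = (g−2)! ∏_{ν ∉ {a(x), t(a(x))}} d_ν`) and `Ψ(θ ∧ H¹(X, ℤ)) = θ^{∧(g−1)} ∧ H¹(X, ℤ) = ⊕_x ℤ · (g−1)! (∏_{ν ≠ a(x)} d_ν) · dx_{(x̄)°} =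
⊕_x ℤ · ((g−1) d_{t(a(x))}) c_x · dx_{(x̄)°}` are DIAGONAL lattices in the basis `(dx_{(x̄)°})_x` of `H^{2g−1}(X, ℤ)`, whose quotient is
`⊕_x ℤ/((g−1) d_{t(a(x))})` (§0: the `c`-scaled coordinates modulo `e`).

* §4 (appended, gen 39 row g39-#11) `IsSymplecticEnum.nonempty_addEquiv_quotient_map_wedge_sup_integralPrimitive_three_of_eq_natCast_smul`
  (the MINIMAL class `θ/d₁` in place of `θ`: `⊕_x ℤ/((g−1) · d_{t(a(x))}/d₁)`), `IsPolarizationType.…`.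

## References

* [cite: Lange2023AbelianVarietiesComplex, §5.4.1 Thm. 5.4.1, Thm. 5.4.2 and (5.22) (PDF p. 275); §2.5.3 Lemma 2.5.14, Thm. 2.5.16,
  Cor. 2.5.17 (c) (PDF p. 135); §1.5.1 (types, PDF p. 51); §2.1.1 (principal); §1.1.3 Exercise 1.1.6 (7)–(8); §6.2.4 proof of
  Prop. 6.2.20 (PDF p. 310)]
* [cite: VoisinHodgeI2002, §6.2.3 Thm. 6.25 and Cor. 6.26 (PDF p. 125–126); §7.1.2 (PDF p. 134 L31)]
-/

noncomputable section

open Module Function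
open Literature.LinearAlgebra.Alternating

namespace Literature.Geometry.Kaehler.ComplexTorus

section DegreeThreeQuotient

variable {ι : Type*} [Fintype ι] [DecidableEq ι] {E : Type*} [NormedAddCommGroup E] [NormedSpace ℂ E]
  (Φ : (ι → ℝ) ≃L[ℝ] E) {j : ℕ} {e₀ : Fin (j + 2) ⊕ Fin (j + 2) ≃ ι} {η : E [⋀^Fin 2]→L[ℝ] ℝ} {d : Fin (j + 2) → ℕ}

/-! ## §0 Two lattice lemmas: the first isomorphism theorem with a kernel part; the quotient of two diagonal lattices -/

omit [Fintype ι] [DecidableEq ι] Φ in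
/-- **`H/(K ⊕ (H ∩ ker f)) ≃+ f(H)/f(K)`** for a homomorphism `f` of abelian groups and `K ≤ H`: `x ↦ [f x]` is onto `f(H)/f(K)` with
kernel `{x ∈ H | f x ∈ f K} = K + (H ∩ ker f)` (the group form of g37-#1's `relIndex_sup_inf_ker_eq_relIndex_map`). [folklore] -/
private theorem nonempty_addEquiv_quotient_sup_inf_ker₃₈ {M N : Type*} [AddCommGroup M] [AddCommGroup N] (f : M →+ N)
    {K H : AddSubgroup M} (hKH : K ≤ H) :
    Nonempty (↥H ⧸ (K ⊔ (H ⊓ f.ker)).addSubgroupOf H ≃+ ↥(H.map f) ⧸ (K.map f).addSubgroupOf (H.map f)) := by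
  haveI hN₁ : ((K.map f).addSubgroupOf (H.map f)).Normal := AddSubgroup.normal_of_isAddCommutative _
  haveI hN₂ : ((K ⊔ (H ⊓ f.ker)).addSubgroupOf H).Normal := AddSubgroup.normal_of_isAddCommutative _
  let Λ : ↥H →+ ↥(H.map f) :=
    AddMonoidHom.mk' (fun x ↦ ⟨f x.1, AddSubgroup.mem_map_of_mem f x.2⟩) (fun a b ↦ Subtype.ext (map_add f a.1 b.1))
  let Ψ : ↥H →+ ↥(H.map f) ⧸ (K.map f).addSubgroupOf (H.map f) :=
    (QuotientAddGroup.mk' ((K.map f).addSubgroupOf (H.map f))).comp Λ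
  have hΨ : ∀ x, Ψ x = QuotientAddGroup.mk (Λ x) := fun _ ↦ rfl
  have hsurj : Function.Surjective Ψ := by
    intro q
    obtain ⟨⟨_, x, hx, rfl⟩, rfl⟩ := QuotientAddGroup.mk_surjective q
    exact ⟨⟨x, hx⟩, rfl⟩
  have hker : Ψ.ker = (K ⊔ (H ⊓ f.ker)).addSubgroupOf H := by
    refine AddSubgroup.ext fun x ↦ ?_
    rw [AddMonoidHom.mem_ker, hΨ, @QuotientAddGroup.eq_zero_iff _ _ ((K.map f).addSubgroupOf (H.map f)) hN₁ (Λ x),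
      AddSubgroup.mem_addSubgroupOf, AddSubgroup.mem_addSubgroupOf, AddSubgroup.mem_map]
    change (∃ k ∈ K, f k = f x.1) ↔ _
    constructor
    · rintro ⟨k, hk, hfk⟩
      exact AddSubgroup.mem_sup.2 ⟨k, hk, x.1 - k,
        ⟨H.sub_mem x.2 (hKH hk), AddMonoidHom.mem_ker.2 (by rw [map_sub, hfk, sub_self])⟩, add_sub_cancel k x.1⟩
    · intro hx
      obtain ⟨k, hk, z, ⟨-, hz⟩, hkz⟩ := AddSubgroup.mem_sup.1 hx
      refine ⟨k, hk, ?_⟩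
      rw [← hkz, map_add, (AddMonoidHom.mem_ker).1 hz, add_zero]
  haveI hN₃ : Ψ.ker.Normal := AddSubgroup.normal_of_isAddCommutative _
  exact ⟨(QuotientAddGroup.quotientAddEquivOfEq hker).symm.trans (QuotientAddGroup.quotientKerEquivOfSurjective Ψ hsurj)⟩

omit [Fintype ι] [DecidableEq ι] Φ in
/-- **The quotient of two diagonal lattices.** In a free lattice `W` with basis `(b_k)`, the subgroups `L₁ = ⊕_k ℤ c_k b_k` and
`L₂ = ⊕_k ℤ e_k c_k b_k` (`c_k ≠ 0`, `e_k ≥ 1`) satisfy `L₁/L₂ ≃+ ⊕_k ℤ/e_k`: `L₁` is free on `(c_k b_k)` (g37-#1 §0) and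
`ℓ = Σ r_k c_k b_k ∈ L₂ ⟺ e_k ∣ r_k` for all `k`; the isomorphism is `ℓ ↦ (r_k mod e_k)_k`.
[cite: Lange2023AbelianVarietiesComplex, §1.1.3 Exercise 1.1.6 (8)] -/
private theorem nonempty_addEquiv_quotient_pi_zmod_of_smul_basis₃₈ {M : Type*} [AddCommGroup M] {κ : Type*} [Fintype κ]
    [DecidableEq κ] {W L₁ L₂ : AddSubgroup M} (b : Basis κ ℤ ↥(AddSubgroup.toIntSubmodule W)) (c : κ → ℤ) (e : κ → ℕ)
    (hc : ∀ k, c k ≠ 0) (he : ∀ k, 0 < e k)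
    (h₁ : L₁ = AddSubgroup.closure (Set.range fun k ↦ c k • ((b k : ↥(AddSubgroup.toIntSubmodule W)) : M)))
    (h₂ : L₂ = AddSubgroup.closure (Set.range fun k ↦ ((e k : ℤ) * c k) • ((b k : ↥(AddSubgroup.toIntSubmodule W)) : M))) :
    Nonempty (↥L₁ ⧸ L₂.addSubgroupOf L₁ ≃+ ((k : κ) → ZMod (e k))) := by
  haveI : ∀ k, NeZero (e k) := fun k ↦ ⟨(he k).ne'⟩
  haveI hN₁ : (L₂.addSubgroupOf L₁).Normal := AddSubgroup.normal_of_isAddCommutative _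
  have hle : L₁ ≤ W := by
    rw [h₁, AddSubgroup.closure_le]
    rintro _ ⟨k, rfl⟩
    exact W.zsmul_mem (SetLike.coe_mem _) _
  have hle₂ : AddSubgroup.closure (Set.range fun k ↦ ((e k : ℤ) * c k) • ((b k : ↥(AddSubgroup.toIntSubmodule W)) : M)) ≤ W := by
    rw [AddSubgroup.closure_le]
    rintro _ ⟨k, rfl⟩
    exact W.zsmul_mem (SetLike.coe_mem _) _
  -- the basis `v k = c k • b k` of `L₁` (as in g37-#1 §0)
  have h₁mem : ∀ k, c k • ((b k : ↥(AddSubgroup.toIntSubmodule W)) : M) ∈ L₁ := fun k ↦ by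
    rw [h₁]
    exact AddSubgroup.subset_closure ⟨k, rfl⟩
  let v : κ → ↥(AddSubgroup.toIntSubmodule L₁) := fun k ↦
    ⟨c k • ((b k : ↥(AddSubgroup.toIntSubmodule W)) : M), h₁mem k⟩
  have hv : ∀ k, ((v k : ↥(AddSubgroup.toIntSubmodule L₁)) : M) =
      c k • ((b k : ↥(AddSubgroup.toIntSubmodule W)) : M) := fun _ ↦ rfl
  have hli₂ : LinearIndependent ℤ fun k ↦ c k • b k := by
    refine linearIndependent_iff'.2 fun s a ha k hk ↦ ?_
    have ha' : ∑ i ∈ s, (a i * c i) • b i = 0 := by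
      simpa only [mul_smul] using ha
    exact (mul_eq_zero.1 (linearIndependent_iff'.1 b.linearIndependent s _ ha' k hk)).resolve_right (hc k)
  have hliM : LinearIndependent ℤ fun k ↦ c k • ((b k : ↥(AddSubgroup.toIntSubmodule W)) : M) := by
    have h' := hli₂.map' (AddSubgroup.toIntSubmodule W).subtype (Submodule.ker_subtype _)
    refine (linearIndependent_equiv' (Equiv.refl κ) ?_).1 h'
    funext k
    simp only [comp_apply, Equiv.coe_refl, id_eq, Submodule.subtype_apply, Submodule.coe_smul_of_tower]
  have hli₁ : LinearIndependent ℤ v :=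
    LinearIndependent.of_comp (AddSubgroup.toIntSubmodule L₁).subtype
      ((linearIndependent_equiv' (Equiv.refl κ) (funext fun k ↦ by rfl)).1 hliM)
  have hsp : ⊤ ≤ Submodule.span ℤ (Set.range v) := by
    rintro x -
    have hx : (x : M) ∈ AddSubgroup.closure
        (Set.range fun k ↦ c k • ((b k : ↥(AddSubgroup.toIntSubmodule W)) : M)) := h₁.le x.2
    have hrange : (Set.range fun k ↦ c k • ((b k : ↥(AddSubgroup.toIntSubmodule W)) : M)) =
        (AddSubgroup.toIntSubmodule L₁).subtype '' Set.range v := by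
      rw [← Set.range_comp]; rfl
    rw [hrange, ← Submodule.span_int_eq_addSubgroupClosure, ← Submodule.map_span] at hx
    obtain ⟨y, hy, hyx⟩ := hx
    rwa [show x = y from Subtype.ext hyx.symm]
  let b₁ : Basis κ ℤ ↥(AddSubgroup.toIntSubmodule L₁) := Basis.mk hli₁ hsp
  have hb₁ : ∀ k, b₁ k = v k := fun k ↦ Basis.mk_apply hli₁ hsp k
  -- coordinates: along `b` of `W` they are `c k` times those along `b₁` of `L₁`
  have hexp : ∀ ℓ : ↥(AddSubgroup.toIntSubmodule L₁),
      (ℓ : M) = ∑ k, (b₁.repr ℓ k * c k) • ((b k : ↥(AddSubgroup.toIntSubmodule W)) : M) := fun ℓ ↦ by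
    conv_lhs => rw [← b₁.sum_repr ℓ]
    rw [Submodule.coe_sum]
    refine Finset.sum_congr rfl fun k _ ↦ ?_
    rw [Submodule.coe_smul_of_tower, hb₁, hv, smul_smul]
  have hcoord : ∀ (ℓ : ↥(AddSubgroup.toIntSubmodule L₁)) (k : κ),
      b.repr ⟨(ℓ : M), hle ℓ.2⟩ k = b₁.repr ℓ k * c k := fun ℓ k ↦ by
    have hsum : (⟨(ℓ : M), hle ℓ.2⟩ : ↥(AddSubgroup.toIntSubmodule W)) = ∑ i, (b₁.repr ℓ i * c i) • b i := by
      apply Subtype.ext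
      rw [Submodule.coe_sum]
      refine (hexp ℓ).trans (Finset.sum_congr rfl fun i _ ↦ ?_)
      rw [Submodule.coe_smul_of_tower]
    rw [hsum, Basis.repr_sum_self]
  -- `Θ : L₁ → ⊕_k ℤ/e_k`, `ℓ ↦ (b₁-coordinates mod e)`
  let Θ : ↥L₁ →+ ((k : κ) → ZMod (e k)) := AddMonoidHom.mk'
    (fun ℓ k ↦ ((b₁.repr ⟨ℓ.1, ℓ.2⟩ k : ℤ) : ZMod (e k)))
    (fun x y ↦ funext fun k ↦ by
      change ((b₁.repr (⟨x.1, x.2⟩ + ⟨y.1, y.2⟩) k : ℤ) : ZMod (e k)) =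
        ((b₁.repr ⟨x.1, x.2⟩ k : ℤ) : ZMod (e k)) + ((b₁.repr ⟨y.1, y.2⟩ k : ℤ) : ZMod (e k))
      rw [map_add, Finsupp.add_apply, Int.cast_add])
  have hΘ : ∀ (ℓ : ↥L₁) (k : κ), Θ ℓ k = ((b₁.repr ⟨ℓ.1, ℓ.2⟩ k : ℤ) : ZMod (e k)) := fun _ _ ↦ rfl
  -- onto: `Σ n_k (c_k b_k) ↦ (n_k)`
  have hsurj : Function.Surjective Θ := fun n ↦ by
    refine ⟨⟨((∑ k, ((n k).val : ℤ) • b₁ k : ↥(AddSubgroup.toIntSubmodule L₁)) : M),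
      (∑ k, ((n k).val : ℤ) • b₁ k : ↥(AddSubgroup.toIntSubmodule L₁)).2⟩, funext fun k ↦ ?_⟩
    rw [hΘ]
    change (((b₁.repr (∑ i, ((n i).val : ℤ) • b₁ i)) k : ℤ) : ZMod (e k)) = n k
    rw [Basis.repr_sum_self, Int.cast_natCast, ZMod.natCast_zmod_val]
  -- kernel: `Σ r_k (c_k b_k) ∈ L₂ ⟺ e_k ∣ r_k`
  have hdvd_of_mem : ∀ (y : M) (hy : y ∈ AddSubgroup.closure
      (Set.range fun k ↦ ((e k : ℤ) * c k) • ((b k : ↥(AddSubgroup.toIntSubmodule W)) : M))) (hyW : y ∈ W) (k : κ),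
      ((e k : ℤ) * c k) ∣ b.repr ⟨y, hyW⟩ k := by
    intro y hy
    refine AddSubgroup.closure_induction (p := fun y _ ↦ ∀ (hyW : y ∈ W) (k : κ), ((e k : ℤ) * c k) ∣ b.repr ⟨y, hyW⟩ k)
      ?_ ?_ ?_ ?_ hy
    · rintro _ ⟨i, rfl⟩ hyW k
      have h0 : (⟨((e i : ℤ) * c i) • ((b i : ↥(AddSubgroup.toIntSubmodule W)) : M), hyW⟩ :
          ↥(AddSubgroup.toIntSubmodule W)) = ((e i : ℤ) * c i) • b i :=
        Subtype.ext (by rw [Submodule.coe_smul_of_tower])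
      rw [h0, map_smul, Basis.repr_self, Finsupp.smul_apply, Finsupp.single_apply, smul_eq_mul]
      by_cases hik : i = k
      · subst hik
        rw [if_pos rfl, mul_one]
      · rw [if_neg hik, mul_zero]
        exact dvd_zero _
    · intro hyW k
      rw [show (⟨0, hyW⟩ : ↥(AddSubgroup.toIntSubmodule W)) = 0 from rfl, map_zero, Finsupp.zero_apply]
      exact dvd_zero _
    · intro x y hx hy ihx ihy hxyW k
      have hxW : x ∈ W := hle₂ hx
      have hyW : y ∈ W := hle₂ hy
      rw [show (⟨x + y, hxyW⟩ : ↥(AddSubgroup.toIntSubmodule W)) = ⟨x, hxW⟩ + ⟨y, hyW⟩ from rfl, map_add,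
        Finsupp.add_apply]
      exact dvd_add (ihx hxW k) (ihy hyW k)
    · intro x hx ihx hxW k
      have hxW' : x ∈ W := hle₂ hx
      rw [show (⟨-x, hxW⟩ : ↥(AddSubgroup.toIntSubmodule W)) = -⟨x, hxW'⟩ from rfl, map_neg, Finsupp.neg_apply]
      exact (ihx hxW' k).neg_right
  have hker : ∀ ℓ : ↥L₁, Θ ℓ = 0 ↔ ℓ ∈ L₂.addSubgroupOf L₁ := fun ℓ ↦ by
    rw [AddSubgroup.mem_addSubgroupOf, funext_iff]
    simp only [hΘ, Pi.zero_apply, ZMod.intCast_zmod_eq_zero_iff_dvd]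
    constructor
    · intro hdvd
      -- `ℓ = Σ_k (r_k / e_k) · (e_k c_k b_k)`
      have hℓ : (ℓ : M) = ∑ k, (b₁.repr ⟨ℓ.1, ℓ.2⟩ k / (e k : ℤ)) •
          (((e k : ℤ) * c k) • ((b k : ↥(AddSubgroup.toIntSubmodule W)) : M)) := by
        refine (hexp ⟨ℓ.1, ℓ.2⟩).trans (Finset.sum_congr rfl fun k _ ↦ ?_)
        rw [smul_smul]
        congr 1
        rw [← mul_assoc, Int.ediv_mul_cancel (hdvd k)]
      rw [hℓ, h₂]
      refine AddSubgroup.sum_mem _ fun k _ ↦ AddSubgroup.zsmul_mem _ ?_ _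
      exact AddSubgroup.subset_closure ⟨k, rfl⟩
    · intro hℓ₂ k
      have hℓ₂' : (ℓ : M) ∈ AddSubgroup.closure
          (Set.range fun k ↦ ((e k : ℤ) * c k) • ((b k : ↥(AddSubgroup.toIntSubmodule W)) : M)) := h₂ ▸ hℓ₂
      have h3 := hdvd_of_mem (ℓ : M) hℓ₂' (hle ℓ.2) k
      rw [hcoord (⟨ℓ.1, ℓ.2⟩ : ↥(AddSubgroup.toIntSubmodule L₁)) k] at h3
      exact (mul_dvd_mul_iff_right (hc k)).1 h3
  have hkerEq : Θ.ker = L₂.addSubgroupOf L₁ := AddSubgroup.ext fun ℓ ↦ by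
    rw [AddMonoidHom.mem_ker]
    exact hker ℓ
  haveI hN₂ : Θ.ker.Normal := AddSubgroup.normal_of_isAddCommutative _
  exact ⟨(QuotientAddGroup.quotientAddEquivOfEq hkerEq).symm.trans (QuotientAddGroup.quotientKerEquivOfSurjective Θ hsurj)⟩

/-- `(g−1)! ∏_{ν ≠ a} d_ν = ((g−1) · d_{t(a)}) · ((g−2)! ∏_{ν ∉ {a, t(a)}} d_ν)` (`t(a)` the largest index `≠ a`; as in g37-#1 §5).
[folklore] -/
private theorem factorial_succ_mul_prod_compl_singleton₃₈ (d : Fin (j + 2) → ℕ) (a : Fin (j + 2)) :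
    (j + 1).factorial * ∏ ν ∈ ({a} : Finset (Fin (j + 2)))ᶜ, d ν =
      ((j + 1) * d (if a = Fin.last (j + 1) then ((Fin.last j).castSucc : Fin (j + 2)) else Fin.last (j + 1))) *
        (j.factorial * ∏ ν ∈ ({a, if a = Fin.last (j + 1) then ((Fin.last j).castSucc : Fin (j + 2)) else Fin.last (j + 1)} :
          Finset (Fin (j + 2)))ᶜ, d ν) := by
  set t : Fin (j + 2) := if a = Fin.last (j + 1) then ((Fin.last j).castSucc : Fin (j + 2)) else Fin.last (j + 1) with ht
  have hta : t ≠ a := by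
    by_cases ha : a = Fin.last (j + 1)
    · rw [ht, if_pos ha, ha]; exact (Fin.castSucc_lt_last _).ne
    · rw [ht, if_neg ha]; exact Ne.symm ha
  have hmem : t ∈ ({a} : Finset (Fin (j + 2)))ᶜ := by rwa [Finset.mem_compl, Finset.mem_singleton]
  have hset : (({a} : Finset (Fin (j + 2)))ᶜ).erase t = ({a, t} : Finset (Fin (j + 2)))ᶜ := by
    ext ν
    simp only [Finset.mem_erase, Finset.mem_compl, Finset.mem_insert, Finset.mem_singleton, not_or]
    tauto
  rw [← Finset.mul_prod_erase _ d hmem, hset, Nat.factorial_succ]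
  ring

/-! ## §1 `H³(X, ℤ)/(P³(X, ℤ) ⊕ θ ∧ H¹(X, ℤ)) ≃+ ⊕_x ℤ/((g−1) · d_{t(a(x))})` -/

/-- **The integral Lefschetz decomposition in degree three as a group.** For a Riemann form `η` on the complex torus
`X = E/Φ(ℤ^ι)` with a symplectic enumeration of type `d = (d₁, …, d_g)` of the lattice basis (`g = j + 2`, `θ = ofRealForm η`,
`Ψ = θ^{∧(g−2)} ∧ (−)`, `P³(X, ℤ) = H³(X, ℤ) ∩ ker Ψ` Lange's primitive lattice `H³_pr(ℂ) ∩ H³_ℤ`):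

  **`H³(X, ℤ)/(θ ∧ H¹(X, ℤ) ⊕ P³(X, ℤ)) ≃+ ⊕_{x ∈ {λ₁, …, μ_g}} ℤ/((g−1) · d_{t(a(x))})`**

(`t(a)` the largest index `≠ a`: `t(a) = g` for `a ≠ g`, `t(g) = g − 1`), i.e. `(ℤ/((g−1) d_g))^{2g−2} ⊕ (ℤ/((g−1) d_{g−1}))²`; the
printed decomposition (5.22) "`H³_ℤ = H³_pr(ℤ) ⊕ L H¹_pr(ℤ)`" holds over `ℤ` up to exactly this group (g37-#1 gave its order).
Proof: `H³/(K ⊕ (H³ ∩ ker Ψ)) ≃+ Ψ(H³)/Ψ(K)` (`K = θ ∧ H¹(X, ℤ)`), and `Ψ(H³(X, ℤ)) = ⊕_x ℤ c_x dx_{(x̄)°}` ⊇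
`Ψ(θ ∧ H¹(X, ℤ)) = ⊕_x ℤ ((g−1) d_{t(a(x))}) c_x dx_{(x̄)°}` are the diagonal lattices of g37-#1 §3–§4.
[cite: Lange2023AbelianVarietiesComplex, §5.4.1 Thm. 5.4.2 and (5.22) (PDF p. 275); §2.5.3 Thm. 2.5.16, Cor. 2.5.17 (c) (PDF p. 135); §1.5.1 (PDF p. 51); §1.1.3 Exercise 1.1.6 (8)] [cite: VoisinHodgeI2002, §6.2.3 Cor. 6.26 (PDF p. 126); §7.1.2 (PDF p. 134 L31)] -/
theorem IsSymplecticEnum.nonempty_addEquiv_quotient_map_wedge_sup_integralPrimitive_three (h : IsSymplecticEnum Φ e₀ η d)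
    (hη : IsRiemannForm Φ η) :
    Nonempty (↥(integralForms Φ 3) ⧸ ((integralForms Φ 1).map (AddMonoidHom.mk'
        (fun x : E [⋀^Fin 1]→L[ℝ] ℂ ↦ ((ofRealForm η).wedge x : E [⋀^Fin 3]→L[ℝ] ℂ))
        (ContinuousAlternatingMap.wedge_add_right _)) ⊔
      (integralForms Φ 3 ⊓ (AddMonoidHom.mk'
        (fun x : E [⋀^Fin 3]→L[ℝ] ℂ ↦ (wedgePow (ofRealForm η) j).wedge x)
        (ContinuousAlternatingMap.wedge_add_right _)).ker)).addSubgroupOf (integralForms Φ 3) ≃+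
      ((x : Fin (j + 2) ⊕ Fin (j + 2)) → ZMod ((j + 1) *
        d (if Sum.elim id id x = Fin.last (j + 1) then ((Fin.last j).castSucc : Fin (j + 2)) else Fin.last (j + 1))))) := by
  classical
  have hn : 1 + (2 * j + 3) = 2 * (j + 2) := by ring
  have hkl : (2 * j + 3) + 1 = Fintype.card ι := lk_eq_card (ilvEnum e₀) hn
  letI : LinearOrder ι := linearOrderOfOrientation (ilvEnum e₀)
  have hKH := map_wedge_integralForms_one_le_three Φ hη.isNSForm
  obtain ⟨e1⟩ := nonempty_addEquiv_quotient_sup_inf_ker₃₈ (AddMonoidHom.mk'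
    (fun x : E [⋀^Fin 3]→L[ℝ] ℂ ↦ (wedgePow (ofRealForm η) j).wedge x) (ContinuousAlternatingMap.wedge_add_right _)) hKH
  obtain ⟨b, hb⟩ := exists_basis_integralForms_coe_eq_latMonomial_complWord Φ e₀ hkl
  -- the two diagonal lattices of g37-#1, rewritten on the basis `b`
  have hc : ∀ x : Fin (j + 2) ⊕ Fin (j + 2), ((j.factorial * ∏ ν ∈ ({Sum.elim id id x,
      if Sum.elim id id x = Fin.last (j + 1) then ((Fin.last j).castSucc : Fin (j + 2)) else Fin.last (j + 1)} :
        Finset (Fin (j + 2)))ᶜ, d ν : ℕ) : ℤ) ≠ 0 := fun x ↦ by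
    exact_mod_cast (Nat.mul_pos (Nat.factorial_pos j) (Finset.prod_pos fun ν _ ↦ h.pos hη ν)).ne'
  have he : ∀ x : Fin (j + 2) ⊕ Fin (j + 2), 0 < (j + 1) *
      d (if Sum.elim id id x = Fin.last (j + 1) then ((Fin.last j).castSucc : Fin (j + 2)) else Fin.last (j + 1)) :=
    fun x ↦ Nat.mul_pos (Nat.succ_pos j) (h.pos hη _)
  have h₁ : (integralForms Φ 3).map (AddMonoidHom.mk'
        (fun x : E [⋀^Fin 3]→L[ℝ] ℂ ↦ (wedgePow (ofRealForm η) j).wedge x) (ContinuousAlternatingMap.wedge_add_right _)) =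
      AddSubgroup.closure (Set.range fun x : Fin (j + 2) ⊕ Fin (j + 2) ↦
        ((j.factorial * ∏ ν ∈ ({Sum.elim id id x,
            if Sum.elim id id x = Fin.last (j + 1) then ((Fin.last j).castSucc : Fin (j + 2)) else Fin.last (j + 1)} :
              Finset (Fin (j + 2)))ᶜ, d ν : ℕ) : ℤ) •
          ((b x : ↥(AddSubgroup.toIntSubmodule (integralForms Φ (2 * j + 3)))) : E [⋀^Fin (2 * j + 3)]→L[ℝ] ℂ)) :=
    (h.map_wedgePow_wedge_integralForms_three_eq_closure Φ hkl).trans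
      (congrArg AddSubgroup.closure (congrArg Set.range (funext fun x ↦ by rw [hb])))
  have h₂ : ((integralForms Φ 1).map (AddMonoidHom.mk'
        (fun x : E [⋀^Fin 1]→L[ℝ] ℂ ↦ ((ofRealForm η).wedge x : E [⋀^Fin 3]→L[ℝ] ℂ))
        (ContinuousAlternatingMap.wedge_add_right _))).map (AddMonoidHom.mk'
        (fun x : E [⋀^Fin 3]→L[ℝ] ℂ ↦ (wedgePow (ofRealForm η) j).wedge x) (ContinuousAlternatingMap.wedge_add_right _)) =
      AddSubgroup.closure (Set.range fun x : Fin (j + 2) ⊕ Fin (j + 2) ↦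
        ((((j + 1) * d (if Sum.elim id id x = Fin.last (j + 1) then ((Fin.last j).castSucc : Fin (j + 2))
            else Fin.last (j + 1)) : ℕ) : ℤ) *
          ((j.factorial * ∏ ν ∈ ({Sum.elim id id x,
            if Sum.elim id id x = Fin.last (j + 1) then ((Fin.last j).castSucc : Fin (j + 2)) else Fin.last (j + 1)} :
              Finset (Fin (j + 2)))ᶜ, d ν : ℕ) : ℤ)) •
          ((b x : ↥(AddSubgroup.toIntSubmodule (integralForms Φ (2 * j + 3)))) : E [⋀^Fin (2 * j + 3)]→L[ℝ] ℂ)) := by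
    refine (h.map_wedgePow_wedge_wedge_integralForms_one_eq_closure Φ hkl).trans
      (congrArg AddSubgroup.closure (congrArg Set.range (funext fun x ↦ ?_)))
    rw [hb, factorial_succ_mul_prod_compl_singleton₃₈ d (Sum.elim id id x), Nat.cast_mul]
  obtain ⟨e2⟩ := nonempty_addEquiv_quotient_pi_zmod_of_smul_basis₃₈ b _ _ hc he h₁ h₂
  exact ⟨e1.trans e2⟩

/-- **Principal type `(1, …, 1)`: `H³(X, ℤ)/(θ ∧ H¹(X, ℤ) ⊕ P³(X, ℤ)) ≃+ (ℤ/(g−1))^{2g}`** (`g = j + 2`) — p.p. threefold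
`(ℤ/2)^6`, p.p. fourfold `(ℤ/3)^8`. [cite: Lange2023AbelianVarietiesComplex, §2.1.1 (principal = type `(1, …, 1)`); §5.4.1 Thm. 5.4.2 and (5.22) (PDF p. 275); §2.5.3 Cor. 2.5.17 (c) (PDF p. 135)] [cite: VoisinHodgeI2002, §6.2.3 Cor. 6.26 (PDF p. 126)] -/
theorem IsSymplecticEnum.nonempty_addEquiv_quotient_map_wedge_sup_integralPrimitive_three_of_type_one
    (h : IsSymplecticEnum Φ e₀ η d) (hη : IsRiemannForm Φ η) (h1 : ∀ i, d i = 1) :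
    Nonempty (↥(integralForms Φ 3) ⧸ ((integralForms Φ 1).map (AddMonoidHom.mk'
        (fun x : E [⋀^Fin 1]→L[ℝ] ℂ ↦ ((ofRealForm η).wedge x : E [⋀^Fin 3]→L[ℝ] ℂ))
        (ContinuousAlternatingMap.wedge_add_right _)) ⊔
      (integralForms Φ 3 ⊓ (AddMonoidHom.mk'
        (fun x : E [⋀^Fin 3]→L[ℝ] ℂ ↦ (wedgePow (ofRealForm η) j).wedge x)
        (ContinuousAlternatingMap.wedge_add_right _)).ker)).addSubgroupOf (integralForms Φ 3) ≃+
      (Fin (j + 2) ⊕ Fin (j + 2) → ZMod (j + 1))) := by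
  obtain ⟨e⟩ := h.nonempty_addEquiv_quotient_map_wedge_sup_integralPrimitive_three Φ hη
  exact ⟨e.trans (AddEquiv.piCongrRight fun x ↦ (ZMod.ringEquivCongr (by rw [h1, mul_one])).toAddEquiv)⟩

/-! ## §2 Basis-free forms: any presentation of a polarised torus of type `(d₁, …, d_g)`; principal polarisations -/

/-- **`H³(X, ℤ)/(θ ∧ H¹(X, ℤ) ⊕ P³(X, ℤ)) ≃+ ⊕_x ℤ/((g−1) · d_{t(a(x))})` for any polarised torus of type `(d₁, …, d_g)`**
(`IsPolarizationType`, `g = j + 2`; any presentation — symplectic re-presentation with the same lattice).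
[cite: Lange2023AbelianVarietiesComplex, §1.5.1 (PDF p. 51); §5.4.1 Thm. 5.4.2 and (5.22) (PDF p. 275); §2.5.3 Cor. 2.5.17 (c) (PDF p. 135)] [cite: VoisinHodgeI2002, §6.2.3 Cor. 6.26 (PDF p. 126); §7.1.2 (PDF p. 134 L31)] -/
theorem IsPolarizationType.nonempty_addEquiv_quotient_map_wedge_sup_integralPrimitive_three {Φ : (ι → ℝ) ≃L[ℝ] E}
    (hd : IsPolarizationType Φ η d) (hη : IsRiemannForm Φ η) :
    Nonempty (↥(integralForms Φ 3) ⧸ ((integralForms Φ 1).map (AddMonoidHom.mk'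
        (fun x : E [⋀^Fin 1]→L[ℝ] ℂ ↦ ((ofRealForm η).wedge x : E [⋀^Fin 3]→L[ℝ] ℂ))
        (ContinuousAlternatingMap.wedge_add_right _)) ⊔
      (integralForms Φ 3 ⊓ (AddMonoidHom.mk'
        (fun x : E [⋀^Fin 3]→L[ℝ] ℂ ↦ (wedgePow (ofRealForm η) j).wedge x)
        (ContinuousAlternatingMap.wedge_add_right _)).ker)).addSubgroupOf (integralForms Φ 3) ≃+
      ((x : Fin (j + 2) ⊕ Fin (j + 2)) → ZMod ((j + 1) *
        d (if Sum.elim id id x = Fin.last (j + 1) then ((Fin.last j).castSucc : Fin (j + 2)) else Fin.last (j + 1))))) := by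
  obtain ⟨Φ', hΛ, hs⟩ := hd.exists_isSymplecticEnum Φ
  rw [integralForms_eq_of_range_latticeVec_eq hΛ.symm 1, integralForms_eq_of_range_latticeVec_eq hΛ.symm 3]
  exact hs.nonempty_addEquiv_quotient_map_wedge_sup_integralPrimitive_three Φ' (hη.of_range_latticeVec_subset hΛ.le)

/-- **The integral Lefschetz decomposition of `H³` for THE type of a Riemann form** (`IsRiemannForm.polarizationType`; `|ι| = 2g`,
`g = j + 2`): `H³(X, ℤ)/(θ ∧ H¹(X, ℤ) ⊕ P³(X, ℤ)) ≃+ ⊕_x ℤ/((g−1) · d_{t(a(x))})`.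
[cite: Lange2023AbelianVarietiesComplex, §1.5.1 (PDF p. 51); §5.4.1 Thm. 5.4.2 and (5.22) (PDF p. 275)] [cite: VoisinHodgeI2002, §6.2.3 Cor. 6.26 (PDF p. 126)] -/
theorem IsRiemannForm.nonempty_addEquiv_quotient_map_wedge_sup_integralPrimitive_three {Φ : (ι → ℝ) ≃L[ℝ] E}
    (hη : IsRiemannForm Φ η) (hj : j + 2 = Fintype.card ι / 2) :
    Nonempty (↥(integralForms Φ 3) ⧸ ((integralForms Φ 1).map (AddMonoidHom.mk'
        (fun x : E [⋀^Fin 1]→L[ℝ] ℂ ↦ ((ofRealForm η).wedge x : E [⋀^Fin 3]→L[ℝ] ℂ))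
        (ContinuousAlternatingMap.wedge_add_right _)) ⊔
      (integralForms Φ 3 ⊓ (AddMonoidHom.mk'
        (fun x : E [⋀^Fin 3]→L[ℝ] ℂ ↦ (wedgePow (ofRealForm η) j).wedge x)
        (ContinuousAlternatingMap.wedge_add_right _)).ker)).addSubgroupOf (integralForms Φ 3) ≃+
      ((x : Fin (j + 2) ⊕ Fin (j + 2)) → ZMod ((j + 1) * hη.polarizationType (Fin.cast hj
        (if Sum.elim id id x = Fin.last (j + 1) then ((Fin.last j).castSucc : Fin (j + 2)) else Fin.last (j + 1)))))) :=
  (hη.isPolarizationType_polarizationType.comp_cast hj).nonempty_addEquiv_quotient_map_wedge_sup_integralPrimitive_three hη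

/-- **Principal polarisation: `H³(X, ℤ)/(θ ∧ H¹(X, ℤ) ⊕ P³(X, ℤ)) ≃+ (ℤ/(g−1))^{2g}`** (`|ι| = 2g`, `g = j + 2`; any presentation):
the integral Lefschetz decomposition of `H³` of a principally polarised torus fails by exactly the group `(ℤ/(g−1))^{2g}` —
`(ℤ/2)^6` for a p.p. threefold, `(ℤ/3)^8` for a p.p. fourfold; it holds over `ℤ` only for a p.p. surface.
[cite: Lange2023AbelianVarietiesComplex, §2.1.1 (principal = type `(1, …, 1)`); §5.4.1 Thm. 5.4.2 and (5.22) (PDF p. 275); §2.5.3 Cor. 2.5.17 (c) (PDF p. 135)] [cite: VoisinHodgeI2002, §6.2.3 Thm. 6.25 and Cor. 6.26 (PDF p. 125–126); §7.1.2 (PDF p. 134 L31)] -/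
theorem IsPrincipalPolarization.nonempty_addEquiv_quotient_map_wedge_sup_integralPrimitive_three {Φ : (ι → ℝ) ≃L[ℝ] E}
    (hp : IsPrincipalPolarization Φ η) (hj : Fintype.card ι = 2 * (j + 2)) :
    Nonempty (↥(integralForms Φ 3) ⧸ ((integralForms Φ 1).map (AddMonoidHom.mk'
        (fun x : E [⋀^Fin 1]→L[ℝ] ℂ ↦ ((ofRealForm η).wedge x : E [⋀^Fin 3]→L[ℝ] ℂ))
        (ContinuousAlternatingMap.wedge_add_right _)) ⊔
      (integralForms Φ 3 ⊓ (AddMonoidHom.mk'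
        (fun x : E [⋀^Fin 3]→L[ℝ] ℂ ↦ (wedgePow (ofRealForm η) j).wedge x)
        (ContinuousAlternatingMap.wedge_add_right _)).ker)).addSubgroupOf (integralForms Φ 3) ≃+
      (Fin (j + 2) ⊕ Fin (j + 2) → ZMod (j + 1))) := by
  obtain ⟨g, d', hd', h1⟩ := hp.exists_type_eq_one
  have hg : j + 2 = g := by have := hd'.card_eq; omega
  obtain ⟨Φ', hΛ, hs⟩ := (hd'.comp_cast hg).exists_isSymplecticEnum Φ
  rw [integralForms_eq_of_range_latticeVec_eq hΛ.symm 1, integralForms_eq_of_range_latticeVec_eq hΛ.symm 3]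
  exact hs.nonempty_addEquiv_quotient_map_wedge_sup_integralPrimitive_three_of_type_one Φ'
    (hp.isRiemannForm.of_range_latticeVec_subset hΛ.le) fun i ↦ h1 _

/-! ## §4 The minimal class `θ/d₁`: `H³(X, ℤ)/((θ/d₁) ∧ H¹(X, ℤ) ⊕ P³(X, ℤ)) ≃+ ⊕_x ℤ/((g−1) · d_{t(a(x))}/d₁)` -/

omit [Fintype ι] [DecidableEq ι] Φ in
/-- Multiplication by a non-zero natural number is injective on complex forms. [folklore] -/
private theorem nsmulAddMonoidHom_injective₃₈ {n : ℕ} (N : ℕ) (hN : N ≠ 0) :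
    Function.Injective (nsmulAddMonoidHom N : (E [⋀^Fin n]→L[ℝ] ℂ) →+ (E [⋀^Fin n]→L[ℝ] ℂ)) := by
  intro x y hxy
  have h : (N : ℂ) • x = (N : ℂ) • y := by
    rw [Nat.cast_smul_eq_nsmul ℂ N x, Nat.cast_smul_eq_nsmul ℂ N y]
    exact hxy
  exact smul_right_injective (E [⋀^Fin n]→L[ℝ] ℂ) (Nat.cast_ne_zero.2 hN) h

/-- **The minimal class in bottom Lefschetz position, degree three: `H³(X, ℤ)/((θ/d₁) ∧ H¹(X, ℤ) ⊕ P³(X, ℤ)) ≃+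
⊕_x ℤ/((g−1) · d_{t(a(x))}/d₁)`** (`g = j + 2`, `t(a)` the largest index `≠ a`; any integral `t` with `θ = d₁ · t` — `θ = Σ d_ν dx_{λ_ν} ∧
dx_{μ_ν}` has content `d₁`, and such a `t` exists for every type, `IsSymplecticEnum.exists_primitive_ofRealForm_eq_smul` of
`ComplexTorusMinimalClasses`). Replacing `θ ∧ H¹(X, ℤ)` by its saturation-candidate `(θ/d₁) ∧ H¹(X, ℤ)` divides every elementary divisor of
§1 by `d₁`: `θ^{∧(g−2)} ∧ ((θ/d₁) ∧ H¹(X, ℤ)) = (1/d₁) · θ^{∧(g−1)} ∧ H¹(X, ℤ)` is again DIAGONAL on the basis of §1 (multiplication by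
`d₁` is injective). For a principal polarisation nothing changes (`(ℤ/(g−1))^{2g}`).
[cite: Lange2023AbelianVarietiesComplex, §5.4.1 Thm. 5.4.2 and (5.22) (PDF p. 275); §1.7.2 Lemma 1.7.4 (PDF p. 72); §2.5.3 Cor. 2.5.17 (c) (PDF p. 135); §1.5.1 (PDF p. 51); §1.1.3 Exercise 1.1.6 (8)] [cite: VoisinHodgeI2002, §6.2.3 Cor. 6.26 (PDF p. 126); §7.1.2 (PDF p. 134 L31)] -/
theorem IsSymplecticEnum.nonempty_addEquiv_quotient_map_wedge_sup_integralPrimitive_three_of_eq_natCast_smul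
    (h : IsSymplecticEnum Φ e₀ η d) (hη : IsRiemannForm Φ η) {t : E [⋀^Fin 2]→L[ℝ] ℂ} (htH : t ∈ integralForms Φ 2)
    (ht : ofRealForm η = ((d 0 : ℕ) : ℂ) • t) :
    Nonempty (↥(integralForms Φ 3) ⧸ (((integralForms Φ 1).map (AddMonoidHom.mk'
        (fun x : E [⋀^Fin 1]→L[ℝ] ℂ ↦ (t.wedge x : E [⋀^Fin 3]→L[ℝ] ℂ)) (ContinuousAlternatingMap.wedge_add_right _))) ⊔
      (integralForms Φ 3 ⊓ (AddMonoidHom.mk'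
        (fun x : E [⋀^Fin 3]→L[ℝ] ℂ ↦ (wedgePow (ofRealForm η) j).wedge x)
        (ContinuousAlternatingMap.wedge_add_right _)).ker)).addSubgroupOf (integralForms Φ 3) ≃+
      ((x : Fin (j + 2) ⊕ Fin (j + 2)) → ZMod ((j + 1) *
        (d (if Sum.elim id id x = Fin.last (j + 1) then ((Fin.last j).castSucc : Fin (j + 2)) else Fin.last (j + 1)) / d 0)))) := by
  classical
  have hn : 1 + (2 * j + 3) = 2 * (j + 2) := by ring
  have hkl : (2 * j + 3) + 1 = Fintype.card ι := lk_eq_card (ilvEnum e₀) hn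
  letI : LinearOrder ι := linearOrderOfOrientation (ilvEnum e₀)
  have h0 : 0 < d 0 := h.pos hη 0
  have hKH : ((integralForms Φ 1).map (AddMonoidHom.mk'
        (fun x : E [⋀^Fin 1]→L[ℝ] ℂ ↦ (t.wedge x : E [⋀^Fin 3]→L[ℝ] ℂ)) (ContinuousAlternatingMap.wedge_add_right _))) ≤ integralForms Φ 3 := by
    rintro _ ⟨x, hx, rfl⟩
    exact wedge_mem_integralForms Φ htH hx
  obtain ⟨e1⟩ := nonempty_addEquiv_quotient_sup_inf_ker₃₈ (AddMonoidHom.mk'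
        (fun x : E [⋀^Fin 3]→L[ℝ] ℂ ↦ (wedgePow (ofRealForm η) j).wedge x) (ContinuousAlternatingMap.wedge_add_right _)) hKH
  obtain ⟨b, hb⟩ := exists_basis_integralForms_coe_eq_latMonomial_complWord Φ e₀ hkl
  have hc : ∀ x : Fin (j + 2) ⊕ Fin (j + 2), ((j.factorial * ∏ ν ∈ ({Sum.elim id id x,
            if Sum.elim id id x = Fin.last (j + 1) then ((Fin.last j).castSucc : Fin (j + 2)) else Fin.last (j + 1)} :
              Finset (Fin (j + 2)))ᶜ, d ν : ℕ) : ℤ) ≠ 0 := fun x ↦ by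
    exact_mod_cast (Nat.mul_pos (Nat.factorial_pos j) (Finset.prod_pos fun ν _ ↦ h.pos hη ν)).ne'
  have he : ∀ x : Fin (j + 2) ⊕ Fin (j + 2), 0 < (j + 1) * (d (if Sum.elim id id x = Fin.last (j + 1) then ((Fin.last j).castSucc : Fin (j + 2)) else Fin.last (j + 1)) / d 0) := fun x ↦
    Nat.mul_pos (Nat.succ_pos j) (Nat.div_pos (Nat.le_of_dvd (h.pos hη _) (h.dvd 0 _ (Fin.zero_le _))) h0)
  have h₁ : (integralForms Φ 3).map (AddMonoidHom.mk'
        (fun x : E [⋀^Fin 3]→L[ℝ] ℂ ↦ (wedgePow (ofRealForm η) j).wedge x) (ContinuousAlternatingMap.wedge_add_right _)) =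
      AddSubgroup.closure (Set.range fun x : Fin (j + 2) ⊕ Fin (j + 2) ↦ ((j.factorial * ∏ ν ∈ ({Sum.elim id id x,
            if Sum.elim id id x = Fin.last (j + 1) then ((Fin.last j).castSucc : Fin (j + 2)) else Fin.last (j + 1)} :
              Finset (Fin (j + 2)))ᶜ, d ν : ℕ) : ℤ) • ((b x : ↥(AddSubgroup.toIntSubmodule (integralForms Φ (2 * j + 3)))) : E [⋀^Fin (2 * j + 3)]→L[ℝ] ℂ)) :=
    (h.map_wedgePow_wedge_integralForms_three_eq_closure Φ hkl).trans
      (congrArg AddSubgroup.closure (congrArg Set.range (funext fun x ↦ by rw [hb])))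
  -- the image of `θ ∧ H¹(X, ℤ)` (§1) is `d₁` times the image of `t ∧ H¹(X, ℤ)`
  have h₂ : (((integralForms Φ 1).map (AddMonoidHom.mk'
        (fun x : E [⋀^Fin 1]→L[ℝ] ℂ ↦ ((ofRealForm η).wedge x : E [⋀^Fin 3]→L[ℝ] ℂ))
        (ContinuousAlternatingMap.wedge_add_right _))).map (AddMonoidHom.mk'
        (fun x : E [⋀^Fin 3]→L[ℝ] ℂ ↦ (wedgePow (ofRealForm η) j).wedge x) (ContinuousAlternatingMap.wedge_add_right _))) =
      AddSubgroup.closure (Set.range fun x : Fin (j + 2) ⊕ Fin (j + 2) ↦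
        ((((j + 1) * d (if Sum.elim id id x = Fin.last (j + 1) then ((Fin.last j).castSucc : Fin (j + 2)) else Fin.last (j + 1)) : ℕ) : ℤ) * ((j.factorial * ∏ ν ∈ ({Sum.elim id id x,
            if Sum.elim id id x = Fin.last (j + 1) then ((Fin.last j).castSucc : Fin (j + 2)) else Fin.last (j + 1)} :
              Finset (Fin (j + 2)))ᶜ, d ν : ℕ) : ℤ)) • ((b x : ↥(AddSubgroup.toIntSubmodule (integralForms Φ (2 * j + 3)))) : E [⋀^Fin (2 * j + 3)]→L[ℝ] ℂ)) := by
    refine (h.map_wedgePow_wedge_wedge_integralForms_one_eq_closure Φ hkl).trans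
      (congrArg AddSubgroup.closure (congrArg Set.range (funext fun x ↦ ?_)))
    rw [hb, factorial_succ_mul_prod_compl_singleton₃₈ d (Sum.elim id id x), Nat.cast_mul]
  have hθt : (AddMonoidHom.mk' (fun x : E [⋀^Fin 1]→L[ℝ] ℂ ↦ ((ofRealForm η).wedge x : E [⋀^Fin 3]→L[ℝ] ℂ))
      (ContinuousAlternatingMap.wedge_add_right _)) = (nsmulAddMonoidHom (d 0) : (E [⋀^Fin 3]→L[ℝ] ℂ) →+ _).comp
      (AddMonoidHom.mk' (fun x : E [⋀^Fin 1]→L[ℝ] ℂ ↦ (t.wedge x : E [⋀^Fin 3]→L[ℝ] ℂ)) (ContinuousAlternatingMap.wedge_add_right _)) := by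
    refine AddMonoidHom.ext fun x ↦ ?_
    rw [AddMonoidHom.comp_apply, AddMonoidHom.mk'_apply, AddMonoidHom.mk'_apply, nsmulAddMonoidHom_apply, ht, wedge_smul_left_complex]
    exact Nat.cast_smul_eq_nsmul ℂ (d 0) (t.wedge x)
  have hΨn : ((AddMonoidHom.mk'
        (fun x : E [⋀^Fin 3]→L[ℝ] ℂ ↦ (wedgePow (ofRealForm η) j).wedge x) (ContinuousAlternatingMap.wedge_add_right _))).comp (nsmulAddMonoidHom (d 0)) = (nsmulAddMonoidHom (d 0) : (E [⋀^Fin (2 * j + 3)]→L[ℝ] ℂ) →+ _).comp (AddMonoidHom.mk'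
        (fun x : E [⋀^Fin 3]→L[ℝ] ℂ ↦ (wedgePow (ofRealForm η) j).wedge x) (ContinuousAlternatingMap.wedge_add_right _)) :=
    AddMonoidHom.ext fun x ↦ by
      rw [AddMonoidHom.comp_apply, AddMonoidHom.comp_apply, nsmulAddMonoidHom_apply, nsmulAddMonoidHom_apply, map_nsmul]
  have h₂' : (((integralForms Φ 1).map (AddMonoidHom.mk'
        (fun x : E [⋀^Fin 1]→L[ℝ] ℂ ↦ (t.wedge x : E [⋀^Fin 3]→L[ℝ] ℂ)) (ContinuousAlternatingMap.wedge_add_right _)))).map (AddMonoidHom.mk'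
        (fun x : E [⋀^Fin 3]→L[ℝ] ℂ ↦ (wedgePow (ofRealForm η) j).wedge x) (ContinuousAlternatingMap.wedge_add_right _)) =
      AddSubgroup.closure (Set.range fun x : Fin (j + 2) ⊕ Fin (j + 2) ↦
        ((((j + 1) * (d (if Sum.elim id id x = Fin.last (j + 1) then ((Fin.last j).castSucc : Fin (j + 2)) else Fin.last (j + 1)) / d 0) : ℕ) : ℤ) * ((j.factorial * ∏ ν ∈ ({Sum.elim id id x,
            if Sum.elim id id x = Fin.last (j + 1) then ((Fin.last j).castSucc : Fin (j + 2)) else Fin.last (j + 1)} :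
              Finset (Fin (j + 2)))ᶜ, d ν : ℕ) : ℤ)) • ((b x : ↥(AddSubgroup.toIntSubmodule (integralForms Φ (2 * j + 3)))) : E [⋀^Fin (2 * j + 3)]→L[ℝ] ℂ)) := by
    refine AddSubgroup.map_injective (nsmulAddMonoidHom_injective₃₈ (n := 2 * j + 3) (d 0) h0.ne') ?_
    have eq1 : (((integralForms Φ 1).map (AddMonoidHom.mk'
        (fun x : E [⋀^Fin 1]→L[ℝ] ℂ ↦ (t.wedge x : E [⋀^Fin 3]→L[ℝ] ℂ)) (ContinuousAlternatingMap.wedge_add_right _))).map (AddMonoidHom.mk'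
        (fun x : E [⋀^Fin 3]→L[ℝ] ℂ ↦ (wedgePow (ofRealForm η) j).wedge x) (ContinuousAlternatingMap.wedge_add_right _))).map (nsmulAddMonoidHom (d 0) : (E [⋀^Fin (2 * j + 3)]→L[ℝ] ℂ) →+ _) =
        (((integralForms Φ 1).map (AddMonoidHom.mk'
        (fun x : E [⋀^Fin 1]→L[ℝ] ℂ ↦ (t.wedge x : E [⋀^Fin 3]→L[ℝ] ℂ)) (ContinuousAlternatingMap.wedge_add_right _))).map (nsmulAddMonoidHom (d 0) : (E [⋀^Fin 3]→L[ℝ] ℂ) →+ _)).map (AddMonoidHom.mk'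
        (fun x : E [⋀^Fin 3]→L[ℝ] ℂ ↦ (wedgePow (ofRealForm η) j).wedge x) (ContinuousAlternatingMap.wedge_add_right _)) := by
      simp only [AddSubgroup.map_map]
      rw [← AddMonoidHom.comp_assoc, ← AddMonoidHom.comp_assoc, hΨn]
    have eq2 : ((integralForms Φ 1).map (AddMonoidHom.mk'
        (fun x : E [⋀^Fin 1]→L[ℝ] ℂ ↦ (t.wedge x : E [⋀^Fin 3]→L[ℝ] ℂ)) (ContinuousAlternatingMap.wedge_add_right _))).map (nsmulAddMonoidHom (d 0) : (E [⋀^Fin 3]→L[ℝ] ℂ) →+ _) =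
        (integralForms Φ 1).map (AddMonoidHom.mk' (fun x : E [⋀^Fin 1]→L[ℝ] ℂ ↦ ((ofRealForm η).wedge x : E [⋀^Fin 3]→L[ℝ] ℂ))
          (ContinuousAlternatingMap.wedge_add_right _)) := by
      rw [AddSubgroup.map_map, ← hθt]
    change (((integralForms Φ 1).map (AddMonoidHom.mk'
        (fun x : E [⋀^Fin 1]→L[ℝ] ℂ ↦ (t.wedge x : E [⋀^Fin 3]→L[ℝ] ℂ)) (ContinuousAlternatingMap.wedge_add_right _))).map (AddMonoidHom.mk'
        (fun x : E [⋀^Fin 3]→L[ℝ] ℂ ↦ (wedgePow (ofRealForm η) j).wedge x) (ContinuousAlternatingMap.wedge_add_right _))).map (nsmulAddMonoidHom (d 0) : (E [⋀^Fin (2 * j + 3)]→L[ℝ] ℂ) →+ _) =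
      (AddSubgroup.closure _).map (nsmulAddMonoidHom (d 0) : (E [⋀^Fin (2 * j + 3)]→L[ℝ] ℂ) →+ _)
    rw [eq1, eq2, h₂, AddMonoidHom.map_closure, ← Set.range_comp]
    refine congrArg AddSubgroup.closure (congrArg Set.range (funext fun x ↦ ?_))
    obtain ⟨q, hq⟩ := h.dvd 0 (if Sum.elim id id x = Fin.last (j + 1) then ((Fin.last j).castSucc : Fin (j + 2)) else Fin.last (j + 1)) (Fin.zero_le _)
    rw [Function.comp_apply, nsmulAddMonoidHom_apply, ← natCast_zsmul, smul_smul, hq, Nat.mul_div_cancel_left _ h0]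
    congr 1
    push_cast
    ring
  obtain ⟨e2⟩ := nonempty_addEquiv_quotient_pi_zmod_of_smul_basis₃₈ b _ _ hc he h₁ h₂'
  exact ⟨e1.trans e2⟩

/-- **`H³(X, ℤ)/((θ/d₁) ∧ H¹(X, ℤ) ⊕ P³(X, ℤ)) ≃+ ⊕_x ℤ/((g−1) · d_{t(a(x))}/d₁)` for a Riemann form of type `(d₁, …, d_g)` on a torus
presented by ANY lattice basis and any integral `t` with `θ = d₁ · t`** (`g = j + 2`).
[cite: Lange2023AbelianVarietiesComplex, §5.4.1 Thm. 5.4.2 and (5.22) (PDF p. 275); §1.5.1 (PDF p. 51)] [cite: VoisinHodgeI2002, §6.2.3 Cor. 6.26 (PDF p. 126); §7.1.2 (PDF p. 134 L31)] -/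
theorem IsPolarizationType.nonempty_addEquiv_quotient_map_wedge_sup_integralPrimitive_three_of_eq_natCast_smul
    {Φ : (ι → ℝ) ≃L[ℝ] E} (hd : IsPolarizationType Φ η d) (hη : IsRiemannForm Φ η) {t : E [⋀^Fin 2]→L[ℝ] ℂ}
    (htH : t ∈ integralForms Φ 2) (ht : ofRealForm η = ((d 0 : ℕ) : ℂ) • t) :
    Nonempty (↥(integralForms Φ 3) ⧸ (((integralForms Φ 1).map (AddMonoidHom.mk'
        (fun x : E [⋀^Fin 1]→L[ℝ] ℂ ↦ (t.wedge x : E [⋀^Fin 3]→L[ℝ] ℂ)) (ContinuousAlternatingMap.wedge_add_right _))) ⊔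
      (integralForms Φ 3 ⊓ (AddMonoidHom.mk'
        (fun x : E [⋀^Fin 3]→L[ℝ] ℂ ↦ (wedgePow (ofRealForm η) j).wedge x)
        (ContinuousAlternatingMap.wedge_add_right _)).ker)).addSubgroupOf (integralForms Φ 3) ≃+
      ((x : Fin (j + 2) ⊕ Fin (j + 2)) → ZMod ((j + 1) *
        (d (if Sum.elim id id x = Fin.last (j + 1) then ((Fin.last j).castSucc : Fin (j + 2)) else Fin.last (j + 1)) / d 0)))) := by
  obtain ⟨Φ', hΛ, hs⟩ := hd.exists_isSymplecticEnum Φ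
  rw [integralForms_eq_of_range_latticeVec_eq hΛ.symm 2] at htH
  rw [integralForms_eq_of_range_latticeVec_eq hΛ.symm 1, integralForms_eq_of_range_latticeVec_eq hΛ.symm 3]
  exact hs.nonempty_addEquiv_quotient_map_wedge_sup_integralPrimitive_three_of_eq_natCast_smul Φ'
    (hη.of_range_latticeVec_subset hΛ.le) htH ht

end DegreeThreeQuotient

end Literature.Geometry.Kaehler.ComplexTorus
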